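import Literature.AlgebraicGeometry.Frobenioids.PerfectionFunctoriality
import Literature.AlgebraicGeometry.Frobenioids.PerfectionEndomorphisms
import Literature.AlgebraicGeometry.Frobenioids.PerfectionIsos
import Literature.AlgebraicGeometry.Frobenioids.PerfectionLifting
import Literature.AlgebraicGeometry.Frobenioids.PreFrobenioidEquivalence
import HarnessLib

/-!
# Frobenioids I, Thm. 3.4 (iii) / Prop. 3.2 (ii): complements on the functoriality `G ↦ G^pf` of the
# perfection, and units of `C^pf`

[cite: MochizukiFrdI2008, Thm. 3.4 (iii) p.62]

Mochizuki, *The geometry of Frobenioids I*, Def. 3.1 (ii)/(iii) pp. 56–57, Prop. 3.2 (ii) p. 59, Thm. 3.4 (iii)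
p. 62.  Complements to `PerfectionFunctoriality.lean` (abc-iut-L1-d1: `Perfection.map hG = G^pf` for a functor
`G` compatible with arrows of Frobenius type) needed by [FrdI] Prop. 5.5 (ii) (`PerfectionUntrCommute.lean`,
cell abc-iut, sub-DAG FrdI:Prop5.5(ii)/P55-L03):
* `map_faithful_of_faithful`, `map_full_of_full` — `G^pf` is faithful / full when `G` is (the tree had these
  for an equivalence `Ψ` only: `map_faithful`, `map_full`);
* `degFr_map_map` — `G^pf` preserves Frobenius degrees when `G` preserves all of them;
* `baseMap_repMap_comp` — `Base(G^pf[r]) ≫ Base(G frob_B) = Base(G frob_A) ≫ Base(G r)` (the comparison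
  isomorphisms `G(A^{(a)}) ≅ (G A)^{(a)}` lie under `G A`), from which "`G^pf` lies over the base" follows
  whenever `G` does;
* `exists_endClass_eq_of_unit` — "Prop. 3.2 (ii) applied to units": a unit of `(A, n)` in `C^pf` (base-identity
  linear automorphism for the operations `Perfection.ops`) is the class of a unit of some `A^{(c)}`;
* `conj_unit_isBaseIdentity_isLinear` — conjugating a unit by an isomorphism gives a unit.
DISCLOSURE: only `IsFrobenioid` of the two structure functors is assumed; no statement of the paper is
strengthened; nothing here bears on [IUTchIII] Cor. 3.12.
-/

namespace Literature.AlgebraicGeometry.Frobenioids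

namespace PreFrobenioid

open CategoryTheory Opposite

/-! ### §1 Complements on `Perfection.map` (Thm. 3.4 (iii) functoriality) -/

namespace Perfection

section MapComplements

universe w₁ v₁ v₁' u₁ u₁' w₂ v₂ v₂' u₂ u₂'

variable {D₁ : Type u₁} [Category.{v₁} D₁] {Φ₁ : D₁ᵒᵖ ⥤ CommMonCat.{w₁}}
  {C₁ : Type u₁'} [Category.{v₁'} C₁] {F₁ : C₁ ⥤ ElemFrobenioid Φ₁} {hF₁ : IsFrobenioid F₁}
  {D₂ : Type u₂} [Category.{v₂} D₂] {Φ₂ : D₂ᵒᵖ ⥤ CommMonCat.{w₂}}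
  {C₂ : Type u₂'} [Category.{v₂'} C₂] {F₂ : C₂ ⥤ ElemFrobenioid Φ₂} {hF₂ : IsFrobenioid F₂}
  {G : C₁ ⥤ C₂} (hG : IsFrobeniusCompatible F₁ F₂ G)
include hG

/-- `G^pf` is faithful when `G` is (agreement of the images at a level of `(G A, n) → (G B, m)` is agreement at
the same level of `(A, n) → (B, m)`). [cite: MochizukiFrdI2008, Thm. 3.4 (iii) p.62] -/
theorem map_faithful_of_faithful [G.Faithful] : (map (hF₁ := hF₁) (hF₂ := hF₂) hG).Faithful := by
  refine ⟨fun {X Y} f g h => ?_⟩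
  obtain ⟨r, rfl⟩ := Hom.mk_surjective f
  obtain ⟨s, rfl⟩ := Hom.mk_surjective g
  rw [map_mk, map_mk] at h
  obtain ⟨M, hr, hs, e⟩ := Hom.mk_eq_mk.mp h
  let M₁ : Level X Y := ⟨M.a, M.b, M.eq⟩
  have er : (repMap (hF₁ := hF₁) (hF₂ := hF₂) hG ⟨M₁, Level.lift r.L M₁ hr r.hom⟩).hom =
      Level.lift (levelMap G r.L) (levelMap G M₁) (levelMap_le G hr)
        (repMap (hF₁ := hF₁) (hF₂ := hF₂) hG r).hom :=
    repMap_lift hG r.L M₁ hr r.hom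
  have es : (repMap (hF₁ := hF₁) (hF₂ := hF₂) hG ⟨M₁, Level.lift s.L M₁ hs s.hom⟩).hom =
      Level.lift (levelMap G s.L) (levelMap G M₁) (levelMap_le G hs)
        (repMap (hF₁ := hF₁) (hF₂ := hF₂) hG s).hom :=
    repMap_lift hG s.L M₁ hs s.hom
  change Level.lift (levelMap G r.L) (levelMap G M₁) (levelMap_le G hr) (repMap hG r).hom =
    Level.lift (levelMap G s.L) (levelMap G M₁) (levelMap_le G hs) (repMap hG s).hom at e
  rw [← er, ← es, repMap_hom, repMap_hom, cancel_epi, cancel_mono] at e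
  exact Hom.mk_eq_mk.mpr ⟨M₁, hr, hs, G.map_injective e⟩

/-- `G^pf` is full when `G` is (a representative `(G A)^{(a)} → (G B)^{(b)}` is, after the comparison
isomorphisms, the image of an arrow `A^{(a)} → B^{(b)}`). [cite: MochizukiFrdI2008, Thm. 3.4 (iii) p.62] -/
theorem map_full_of_full [G.Full] : (map (hF₁ := hF₁) (hF₂ := hF₂) hG).Full := by
  refine ⟨fun {X Y} f => ?_⟩
  revert f
  change ∀ f : objMap (hF₂ := hF₂) G X ⟶ objMap (hF₂ := hF₂) G Y, ∃ g : X ⟶ Y, homMap hG g = f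
  intro f
  obtain ⟨⟨L, θ⟩, rfl⟩ := Hom.mk_surjective f
  let L₁ : Level X Y := ⟨L.a, L.b, L.eq⟩
  let θ₁ : L₁.HomAt :=
    G.preimage ((frobPowIso hG X.obj L.a).hom ≫ θ ≫ (frobPowIso hG Y.obj L.b).inv)
  refine ⟨Hom.mk ⟨L₁, θ₁⟩, ?_⟩
  rw [homMap_mk]
  change Hom.mk ⟨L, (frobPowIso hG X.obj L.a).inv ≫ G.map θ₁ ≫ (frobPowIso hG Y.obj L.b).hom⟩ =
    Hom.mk ⟨L, θ⟩
  rw [G.map_preimage]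
  simp only [Category.assoc, Iso.inv_hom_id, Category.comp_id, Iso.inv_hom_id_assoc]

/-- If `G` preserves ALL Frobenius degrees then so does `G^pf` (the comparison isomorphisms are linear).
[cite: MochizukiFrdI2008, Thm. 3.4 (iii) p.62] -/
theorem degFr_map_map (hdeg : ∀ ⦃A B : C₁⦄ (f : A ⟶ B), degFr F₂ (G.map f) = degFr F₁ f)
    {X Y : Perfection hF₁} (f : X ⟶ Y) :
    (ops hF₂).degFr ((map (hF₁ := hF₁) (hF₂ := hF₂) hG).map f) = (ops hF₁).degFr f := by
  obtain ⟨r, rfl⟩ := Hom.mk_surjective f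
  rw [map_mk]
  change PreFrobenioid.degFr F₂ (repMap (hF₁ := hF₁) (hF₂ := hF₂) hG r).hom = PreFrobenioid.degFr F₁ r.hom
  unfold repMap
  dsimp only [objMap, levelMap]
  rw [degFr_iso_comp, degFr_comp_iso, hdeg]

/-- `Base` of `G^pf[r]`, computed through `G`: `Base(G^pf[r]) ≫ Base(G frob_B) = Base(G frob_A) ≫ Base(G r)`
(the comparison isomorphisms `G(A^{(a)}) ≅ (G A)^{(a)}` lie under `G A`). [cite: MochizukiFrdI2008, Def. 3.1 (iii) p.57] -/
theorem baseMap_repMap_comp {X Y : Perfection hF₁} (r : Rep X Y) :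
    (repMap (hF₁ := hF₁) (hF₂ := hF₂) hG r).baseMap ≫ Base F₂ (G.map (frob hF₁ Y.obj r.L.b)) =
      Base F₂ (G.map (frob hF₁ X.obj r.L.a)) ≫ Base F₂ (G.map r.hom) := by
  have hA := map_frob_frobPowIso (hF₁ := hF₁) (hF₂ := hF₂) hG X.obj r.L.a
  have hB := map_frob_frobPowIso (hF₁ := hF₁) (hF₂ := hF₂) hG Y.obj r.L.b
  haveI : IsIso (Base F₂ (frobPowIso (hF₁ := hF₁) (hF₂ := hF₂) hG Y.obj r.L.b).hom) :=
    isBaseIso_of_isIso F₂ _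
  unfold Rep.baseMap repMap
  dsimp only [objMap, levelMap]
  rw [← cancel_mono (Base F₂ (frobPowIso (hF₁ := hF₁) (hF₂ := hF₂) hG Y.obj r.L.b).hom)]
  simp only [Category.assoc]
  rw [← base_comp F₂ (G.map (frob hF₁ Y.obj r.L.b)), hB, baseInvFrob_base_frob, Category.comp_id, ← hA]
  simp only [← base_comp, Category.assoc, Iso.hom_inv_id_assoc]

end MapComplements

/-! ### Units of `C^pf` are classes of units at a diagonal level -/

section Units

universe w v v' u u'

variable {D : Type u} [Category.{v} D] {Φ : Dᵒᵖ ⥤ CommMonCat.{w}}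
  {C : Type u'} [Category.{v'} C] {F : C ⥤ ElemFrobenioid Φ} {hF : IsFrobenioid F}

/-- **"Prop. 3.2 (ii) applied to units"**: a unit of `X = (A, n)` in `C^pf` — an automorphism which is a
base-identity linear endomorphism for the operations of `C^pf` — is the class `[θ]` of a unit `θ ∈ O^×(A^{(c)})`
at some diagonal level `(c, c)` (an isomorphism of `C^pf` has an invertible transport, `PerfectionIsos`; base
and degree are read off at any level). [cite: MochizukiFrdI2008, Prop. 3.2 (ii) p.59] -/
theorem exists_endClass_eq_of_unit {X : Perfection hF} (f : X ⟶ X) [IsIso f]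
    (hb : (ops hF).IsBaseIdentity f) (hl : (ops hF).IsLinear f) :
    ∃ (c : ℕ+) (θ : frobPow hF X.obj c ⟶ frobPow hF X.obj c), endClass X c θ = f ∧ IsIso θ ∧
      IsBaseIdentity F θ ∧ IsLinear F θ := by
  obtain ⟨c₀, θ₀, rfl⟩ := exists_endClass_eq X f
  obtain ⟨⟨a, b, hab⟩, hN, hiso⟩ := exists_isIso_lift_of_isIso ⟨Level.diag X c₀, θ₀⟩ ‹_›
  obtain rfl : a = b := mul_left_cancel hab
  refine ⟨a, Level.lift (Level.diag X c₀) ⟨a, a, hab⟩ hN θ₀, ?_, hiso, ?_, ?_⟩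
  · exact Hom.mk_lift ⟨Level.diag X c₀, θ₀⟩ ⟨a, a, hab⟩ hN
  · refine (isBaseIdentity_endClass_iff X a _).mp ?_
    rw [show endClass X a (Level.lift (Level.diag X c₀) ⟨a, a, hab⟩ hN θ₀) = endClass X c₀ θ₀ from
      Hom.mk_lift ⟨Level.diag X c₀, θ₀⟩ ⟨a, a, hab⟩ hN]
    exact hb
  · refine (isLinear_endClass_iff X a _).mp ?_
    rw [show endClass X a (Level.lift (Level.diag X c₀) ⟨a, a, hab⟩ hN θ₀) = endClass X c₀ θ₀ from
      Hom.mk_lift ⟨Level.diag X c₀, θ₀⟩ ⟨a, a, hab⟩ hN]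
    exact hl

/-- Conjugating a unit by an isomorphism gives a unit: for `c : P ≅ X` and `δ ∈ O^×(X)` the automorphism
`c ≫ δ ≫ c⁻¹` of `P` is base-identity and linear. [cite: MochizukiFrdI2008, Def. 1.2 (ii) p.22] -/
theorem conj_unit_isBaseIdentity_isLinear {P X : Perfection hF} (c : P ≅ X) (δ : Aut X)
    (hδ : δ ∈ (ops hF).unitsSubgroup X) :
    (ops hF).IsBaseIdentity (c.hom ≫ δ.hom ≫ c.inv) ∧ (ops hF).IsLinear (c.hom ≫ δ.hom ≫ c.inv) := by
  refine ⟨?_, ?_⟩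
  · change (ops hF).base.map (c.hom ≫ δ.hom ≫ c.inv) = 𝟙 _
    rw [(ops hF).base.map_comp, (ops hF).base.map_comp, show (ops hF).base.map δ.hom = 𝟙 _ from hδ.1,
      Category.id_comp, ← (ops hF).base.map_comp, Iso.hom_inv_id, (ops hF).base.map_id]
  · change (ops hF).degFr (c.hom ≫ δ.hom ≫ c.inv) = 1
    rw [(ops hF).degFr_comp, (ops hF).degFr_comp, show (ops hF).degFr δ.hom = 1 from hδ.2,
      degFr_eq_one_of_isIso c.hom, degFr_eq_one_of_isIso c.inv, mul_one, mul_one]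

end Units

end Perfection

end PreFrobenioid

end Literature.AlgebraicGeometry.Frobenioids
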